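import Literature.AlgebraicGeometry.Modules.CechProductCoverKunnethBoxTensor
import Literature.AlgebraicGeometry.Modules.ModuleCechRefinementTransport
import Literature.AlgebraicGeometry.AbelianSchemes.AbelianSchemeShearSquare
import Literature.AlgebraicGeometry.AbelianVarieties.PicZeroGlobalSectionsVanishing
import Literature.AlgebraicGeometry.AbelianVarieties.HomogeneousLineBundleMulPullback
import Literature.AlgebraicGeometry.Modules.ModuleCechFiniteOverField
import Literature.AlgebraicGeometry.Modules.FlatteningStratificationDecomposition
import Literature.AlgebraicGeometry.Modules.DetClassTensor
import Literature.AlgebraicGeometry.Modules.VanishingLocusFiniteLocallyFree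
import Mathlib.LinearAlgebra.Dual.Lemmas
import HarnessLib

/-!
# `H^i(A, L) = 0` for every `i` and every non-trivial `L ∈ Pic⁰(A)` (Mumford, *Abelian Varieties*, §8 (vii); Görtz–Wedhorn II, Lemma 27.197)
# — the Čech cohomology of a non-trivial homogeneous line bundle on an abelian variety vanishes in ALL degrees

Layer `Literature/AlgebraicGeometry/AbelianVarieties`, namespace `Literature.AlgebraicGeometry.AbelianVarieties`.  PROOF file (theorems only; no
definition, no named fact, no instance, no notation, no `sorry`).  Cell `hodgecm-mathlib` (D-0151), pay-down programme «H1-DIM in char `p`» (F0P6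
RULINGS «M-25» (2) ∕ «M-28» (2)), file **(D1) = THE HEAD** of the road «`H^i(A, M) = 0` for `M ∈ Pic⁰ ∖ 0`» ([MumfordAV1970] §8 (vii), p. 76),
assembling ★ (K) `Modules/CechProductCoverKunnethBoxTensor`, ★ (C) `Modules/ModuleCechRefinementTransport`, ★ (S)
`AbelianSchemes/AbelianSchemeShearSquare`, ★ (H0) `AbelianVarieties/PicZeroGlobalSectionsVanishing` and [MumfordAV1970] §8 (ii) ★
`cechPic_pullback_mul_detClass` (`m^*[L] = p₁^*[L]·p₂^*[L]`).  Characteristic-free; `k` algebraically closed (the tree's `IsHomogeneous` =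
invariance under the translations by `k`-points, which is `Pic⁰` for `k = k̄`).

THE ARGUMENT ([MumfordAV1970] §8 (vii) read as a statement about the two cartesian structures of `A × A`; no pull-back functoriality of module
Čech cochains is needed).  Fix a finite affine cover `𝓤` of `A`; `L ≅ 𝒪(D)`, `L′ := 𝒪(−D)` (homogeneous, non-trivial, rank one).  Strong
induction on `n`: assume `Ȟᵃ(𝓤, L) = 0` for `a < n`.  On `A × A`, `p₁^*𝒪 ⊗ p₂^*L ≅ p₁^*L′ ⊗ m^*L` (§2: both have the class `p₂^*[L]`,
because `m^*[L] = p₁^*[L]·p₂^*[L]`).  Künneth along the SHEAR square `(p₁, m)` (★ (S) `isPullback_p₁_m`, ★ (K)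
`subsingleton_homology_boxTensor_of_forall`, finiteness by properness ★ `module_finite_homology_cechComplex_scalarRingHomTop`):
`Ȟⁿ(W″, p₁^*L′ ⊗ m^*L) = 0`, every Künneth summand `Ȟᵃ(𝓤, L′) ⊗ Ȟᵇ(𝓤, L)` (`a + b = n`) vanishing — `b < n` by induction, `b ≥ n` forces
`a ≤ 0` and `Ȟ⁰(𝓤, L′) = 0` (★ (H0)), `Ȟᵃ = 0` for `a < 0`.  Cover independence (★ (C), through the common refinement `W` of the product
cover `W₀` and the shear cover `W″`, ★ (S)) and the module isomorphism give `Ȟⁿ(W₀, p₁^*𝒪 ⊗ p₂^*L) = 0`; the Künneth INJECTION along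
`(p₁, p₂)` (★ (K) `subsingleton_tensor_homology_of_subsingleton_homology_boxTensor`) gives `Ȟ⁰(𝓤, 𝒪) ⊗ₖ Ȟⁿ(𝓤, L) = 0`, and `Ȟ⁰(𝓤, 𝒪) = Γ(A, 𝒪) ≠ 0`
(§1) forces `Ȟⁿ(𝓤, L) = 0`.

* §1 linear-algebra and Čech plumbing: `subsingleton_of_subsingleton_tensor_of_ne_zero` (`M ⊗ₖ N = 0`, `0 ≠ m ∈ M` ⇒ `N = 0`),
  `subsingleton_tensor_of_left ∕ _right`, `subsingleton_cechComplex_homology_of_neg`, `nontrivial_cechComplex_homology_zero_unitModule`;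
* §2 `nonempty_boxTensor_unit_iso_boxTensor_neg_mul` — the module isomorphism `p₁^*𝒪 ⊗ p₂^*L ≅ p₁^*𝒪(−D) ⊗ m^*L` on `A × A`;
  `isHomogeneous_lineBundle_neg`, `isEmpty_lineBundle_neg_iso_unit` (`𝒪(−D)` is homogeneous and non-trivial with `L ≅ 𝒪(D)`);
* §3 `subsingleton_cechComplex_homology_step` (the induction step) and the HEAD **`subsingleton_cechComplex_homology_of_isHomogeneous`**:
  `Ȟⁿ(𝓤, L) = 0` for EVERY `n : ℤ`, every finite affine open cover `𝓤` of `A`, `L` rank one homogeneous not `≅ 𝒪_A`, `k = k̄` — scalars through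
  `overRingHom A.X.hom φ₀` (`φ₀ : k ≃ Γ(Spec k, 𝒪)`), the ring of ★ (K); `subsingleton_cechComplex_homology_of_isHomogeneous'` — the same for the
  F-J3b scalars `scalarRingHomTop A.X` (the two ring maps coincide).

NOT HERE (said, not attempted): the transfer to Mathlib's `Sheaf.H` (★ Leray `Cech.cohomologyAddEquivHomologySucc` + the cochain dictionaries),
which would discharge the `Type`-slice of the named fact ★ `AbelianVarietyPicZeroCohomologyVanishing` — a separate S-sized file.

HC_CM is proved only modulo the printed citations until rung 0 closes — nothing here bears on a summit statement; count-neutral ★ capital.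

## References
* [MumfordAV1970] D. Mumford, *Abelian Varieties* (1970), §8 (vii) (p. 76) (the theorem and its proof), §8 (ii)–(iii) (pp. 74–75).
* [GortzWedhorn2023] U. Görtz, T. Wedhorn, *Algebraic Geometry II* (2023), Lemma 27.197 (PDF p. 893), Cor. 22.110 (Künneth), Thm. 22.9 (p. 236),
  Thm. 23.17 and Cor. 23.18 (finiteness).
* [StacksProject] The Stacks Project, Tag 0BEC (Künneth on the product cover), Tag 01XD, Tag 01FG.
* [Hartshorne1977] R. Hartshorne, *Algebraic Geometry* (1977), III Thm. 4.5, III Ex. 4.5.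
-/

noncomputable section

-- `Scheme.Modules`, `GradedObject` are not reducible (as in ★ (K), ★ `HomogeneousLineBundleMulPullback`).
set_option backward.isDefEq.respectTransparency false

open CategoryTheory CategoryTheory.Limits AlgebraicGeometry TopologicalSpace Opposite MonoidalCategory CartesianMonoidalCategory
  TensorProduct
open scoped MonObj

namespace Literature.AlgebraicGeometry.AbelianVarieties

open Literature.AlgebraicGeometry.Motives Literature.AlgebraicGeometry.Modules Literature.AlgebraicGeometry.Morphisms
  Literature.AlgebraicGeometry.AbelianSchemes Literature.AlgebraicGeometry.AbelianSchemes.AbelianVarietyCech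
  Literature.Algebra.Homology

/-! ## §1 Plumbing -/

section Plumbing

/-- Over a field: if `M ⊗ₖ N = 0` and `M` has a non-zero element, then `N = 0` (a functional `φ` with `φ m ≠ 0`, Mathlib
`Module.forall_dual_apply_eq_zero_iff`; `x = (φ m)⁻¹ (φ m • x)` and `φ m • x = lid ((φ ⊗ 1)(m ⊗ x)) = 0`). [cite: MumfordAV1970, §8 (vii) (p. 76)] -/
theorem subsingleton_of_subsingleton_tensor_of_ne_zero {k : Type*} [Field k] {M N : Type*} [AddCommGroup M] [Module k M]
    [AddCommGroup N] [Module k N] [Subsingleton (M ⊗[k] N)] {m : M} (hm : m ≠ 0) : Subsingleton N := by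
  obtain ⟨φ, hφ⟩ : ∃ φ : Module.Dual k M, φ m ≠ 0 :=
    not_forall.mp (mt (Module.forall_dual_apply_eq_zero_iff k m).1 hm)
  refine ⟨fun x y => ?_⟩
  have key : ∀ z : N, φ m • z = 0 := fun z => by
    have h0 : m ⊗ₜ[k] z = 0 := Subsingleton.elim _ _
    have h1 : TensorProduct.lid k N ((φ.rTensor N) (m ⊗ₜ[k] z)) = φ m • z := by
      rw [LinearMap.rTensor_tmul, TensorProduct.lid_tmul]
    rw [← h1, h0, map_zero, map_zero]
  have hx := key x
  have hy := key y
  rw [smul_eq_zero, or_iff_right hφ] at hx hy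
  rw [hx, hy]

/-- `M = 0 ⇒ M ⊗ N = 0`. [folklore] [cite: StacksProject, Tag 0BEC] -/
theorem subsingleton_tensor_of_left {R : Type*} [CommRing R] {M N : Type*} [AddCommGroup M] [Module R M] [AddCommGroup N] [Module R N]
    [Subsingleton M] : Subsingleton (M ⊗[R] N) := by
  refine ⟨fun x y => ?_⟩
  have h : ∀ z : M ⊗[R] N, z = 0 := fun z => by
    induction z using TensorProduct.induction_on with
    | zero => rfl
    | tmul a b => rw [Subsingleton.elim a 0, TensorProduct.zero_tmul]
    | add a b ha hb => rw [ha, hb, add_zero]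
  rw [h x, h y]

/-- `N = 0 ⇒ M ⊗ N = 0`. [folklore] [cite: StacksProject, Tag 0BEC] -/
theorem subsingleton_tensor_of_right {R : Type*} [CommRing R] {M N : Type*} [AddCommGroup M] [Module R M] [AddCommGroup N] [Module R N]
    [Subsingleton N] : Subsingleton (M ⊗[R] N) := by
  refine ⟨fun x y => ?_⟩
  have h : ∀ z : M ⊗[R] N, z = 0 := fun z => by
    induction z using TensorProduct.induction_on with
    | zero => rfl
    | tmul a b => rw [Subsingleton.elim b 0, TensorProduct.tmul_zero]
    | add a b ha hb => rw [ha, hb, add_zero]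
  rw [h x, h y]

variable {X : Scheme.{0}} {J : Type} [LinearOrder J] (𝓥 : J → X.Opens) (L : X.Modules) {A : Type} [CommRing A] (ρ : A →+* Γ(X, ⊤))

/-- `Ȟⁿ(𝓥, L) = 0` for `n < 0` (the ordered Čech complex vanishes in negative degrees). [cite: GortzWedhorn2023, Def. 21.68 (p. 180)] -/
theorem subsingleton_cechComplex_homology_of_neg (n : ℤ) (hn : n < 0) : Subsingleton ((cechComplex 𝓥 L ρ).homology n) :=
  ModuleCat.subsingleton_of_isZero (ShortComplex.isZero_homology_of_isZero_X₂ _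
    (OrderedCech.isZero_sysComplex_X_of_neg (sectionsSystem 𝓥 L ρ) n hn))

/-- **`Ȟ⁰(𝓥, 𝒪_X) ≠ 0`** for a cover `𝓥` of an INTEGRAL scheme `X` (`Ȟ⁰ ≅ Γ(X, 𝒪)` ★ `nonempty_secMod_linearEquiv_homology_zero`, and
`Γ(X, 𝒪)` is a domain). [cite: GortzWedhorn2023, Lemma 21.65 (p. 179)] -/
theorem nontrivial_cechComplex_homology_zero_unitModule [IsIntegral X] (hcov : ⨆ i, 𝓥 i = ⊤) :
    Nontrivial ((cechComplex 𝓥 (unitModule X) ρ).homology 0) := by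
  obtain ⟨e⟩ := nonempty_secMod_linearEquiv_homology_zero (G := unitModule X) (W := 𝓥) ρ hcov
  haveI : Nonempty (⊤ : X.Opens) := ⟨⟨genericPoint X, trivial⟩⟩
  have h01 : SecMod.ofRing ρ (0 : Γ(X, ⊤)) ≠ SecMod.ofRing ρ (1 : Γ(X, ⊤)) := by
    intro h
    have h' := congrArg (SecMod.toRing ρ) h
    rw [SecMod.toRing_ofRing, SecMod.toRing_ofRing] at h'
    exact zero_ne_one h'
  exact ⟨⟨e (SecMod.ofRing ρ 0), e (SecMod.ofRing ρ 1), fun h => h01 (e.injective h)⟩⟩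

end Plumbing

/-! ## §2 The module isomorphism `p₁^*𝒪 ⊗ p₂^*L ≅ p₁^*𝒪(−D) ⊗ m^*L` on `A × A`, and `𝒪(−D)` -/

section Iso

variable {K : Type} [Field K] [IsAlgClosed K] (B : AbelianVariety K)

omit [IsAlgClosed K] in
/-- `𝒪(−D)` is homogeneous when `𝒪(D)` is: `t_P^*[−D] = (t_P^*[D])⁻¹ = [D]⁻¹ = [−D]`. [cite: MumfordAV1970, §8 (i) (p. 74)] -/
theorem isHomogeneous_lineBundle_neg (D : CartierDivisor B.X.left)
    (hZ : ∀ P : B.Points K, (D.pullback (B.translation P).left).LinEquiv D) :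
    IsHomogeneous B (lineBundle (-D).toUnitCocycle) := by
  refine (isHomogeneous_iff_forall_pullback_detClass_eq B (-D).toUnitCocycle.hasRank_lineBundle
    (-D).toUnitCocycle.isFiniteLocallyFree_lineBundle).2 fun P => ?_
  have h := (CartierDivisor.cechClass_eq_iff_linEquiv _ _).2 (hZ P)
  rw [CartierDivisor.cechClass_pullback] at h
  rw [detClass_lineBundle_toUnitCocycle, AbelianSchemes.AbelianSchemeOver.cechClass_neg_eq_inv', map_inv, h]

omit [IsAlgClosed K] in
/-- `𝒪(−D)` is not trivial when `L ≅ 𝒪(D)` is not: `[−D] = 1 ⇒ [D] = 1 ⇒ [det L] = 1 ⇒ L ≅ 𝒪`. [cite: Hartshorne1977, III Ex. 4.5] -/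
theorem isEmpty_lineBundle_neg_iso_unit {L : B.X.left.Modules} (h₁ : HasRank L 1) (hne : IsEmpty (L ≅ unitModule B.X.left))
    {D : CartierDivisor B.X.left} (e : L ≅ lineBundle D.toUnitCocycle) :
    IsEmpty (lineBundle (-D).toUnitCocycle ≅ unitModule B.X.left) := by
  refine ⟨fun i => hne.false (nonempty_iso_unitModule_of_detClass_eq_one h₁ (HasRank.isFiniteLocallyFree' h₁) ?_).some⟩
  have hneg : detClass (-D).toUnitCocycle.isFiniteLocallyFree_lineBundle = 1 := by
    rw [detClass_eq_of_iso i (-D).toUnitCocycle.isFiniteLocallyFree_lineBundle (HasRank.isFiniteLocallyFree' hasRank_unitModule),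
      detClass_unitModule_eq_one]
  rw [detClass_lineBundle_toUnitCocycle, AbelianSchemes.AbelianSchemeOver.cechClass_neg_eq_inv', inv_eq_one] at hneg
  rw [detClass_eq_of_iso e (HasRank.isFiniteLocallyFree' h₁) D.toUnitCocycle.isFiniteLocallyFree_lineBundle,
    detClass_lineBundle_toUnitCocycle, hneg]

/-- **`p₁^*𝒪 ⊗ p₂^*L ≅ p₁^*𝒪(−D) ⊗ m^*L` on `A × A`** for `L ≅ 𝒪(D)` homogeneous over `k = k̄`: both sides are rank-one modules with the class
`p₂^*[L]`, since `m^*[L] = p₁^*[L]·p₂^*[L]` ([MumfordAV1970] §8 (ii), ★ `cechPic_pullback_mul_detClass`) and `[𝒪(−D)] = [L]⁻¹`; rank-one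
modules are classified by their class (★ `nonempty_iso_iff_detClass_eq`).  In the `boxTensor` spelling of ★ (K): `𝒪 ⊠_{(p₁,p₂)} L ≅ 𝒪(−D) ⊠_{(p₁,m)} L`.
[cite: MumfordAV1970, §8 (ii)–(iii) (pp. 74–75) and (vii) (p. 76)] [cite: Hartshorne1977, III Ex. 4.5] -/
theorem nonempty_boxTensor_unit_iso_boxTensor_neg_mul {L : B.X.left.Modules} (h₁ : HasRank L 1) (hL : IsHomogeneous B L)
    {D : CartierDivisor B.X.left} (e : L ≅ lineBundle D.toUnitCocycle) :
    Nonempty (boxTensor (p₁ (AbelianSchemeOver.ofAbelianVariety B)) (p₂ (AbelianSchemeOver.ofAbelianVariety B))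
        (unitModule B.X.left) L ≅
      boxTensor (p₁ (AbelianSchemeOver.ofAbelianVariety B)) (m (AbelianSchemeOver.ofAbelianVariety B))
        (lineBundle (-D).toUnitCocycle) L) := by
  set A := AbelianSchemeOver.ofAbelianVariety B
  have hL₀ : IsFiniteLocallyFree L := HasRank.isFiniteLocallyFree' h₁
  have hU₁ : HasRank (unitModule B.X.left) 1 := hasRank_unitModule
  have hU₀ : IsFiniteLocallyFree (unitModule B.X.left) := HasRank.isFiniteLocallyFree' hU₁
  have hN₁ : HasRank (lineBundle (-D).toUnitCocycle) 1 := (-D).toUnitCocycle.hasRank_lineBundle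
  have hN₀ : IsFiniteLocallyFree (lineBundle (-D).toUnitCocycle) := (-D).toUnitCocycle.isFiniteLocallyFree_lineBundle
  -- the classes
  have hLD : detClass hL₀ = D.cechClass := by
    rw [detClass_eq_of_iso e hL₀ D.toUnitCocycle.isFiniteLocallyFree_lineBundle, detClass_lineBundle_toUnitCocycle]
  have hND : detClass hN₀ = D.cechClass⁻¹ := by
    rw [detClass_lineBundle_toUnitCocycle, AbelianSchemes.AbelianSchemeOver.cechClass_neg_eq_inv']
  -- `m^*[L] = p₁^*[L]·p₂^*[L]`
  have hmul := cechPic_pullback_mul_detClass B h₁ hL₀ hL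
  have hm : (fst B.X B.X * snd B.X B.X).left = m A := by
    change (lift (fst B.X B.X) (snd B.X B.X) ≫ μ[B.X]).left = m A
    rw [lift_fst_snd, Category.id_comp]
  have hmul' : CechPic.pullback (m A) (detClass hL₀) =
      CechPic.pullback (p₁ A) (detClass hL₀) * CechPic.pullback (p₂ A) (detClass hL₀) := by
    rw [← hm]; exact hmul
  refine (nonempty_iso_iff_detClass_eq
    (hasRank_tensorObj_one (hasRank_pullback _ hU₁) (hasRank_pullback _ h₁))
    (hasRank_tensorObj_one (hasRank_pullback _ hN₁) (hasRank_pullback _ h₁))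
    (isFiniteLocallyFree_tensorObj _ _ (hU₀.pullback _) (hL₀.pullback _))
    (isFiniteLocallyFree_tensorObj _ _ (hN₀.pullback _) (hL₀.pullback _))).2 ?_
  have lhs : detClass (isFiniteLocallyFree_tensorObj _ _ (hU₀.pullback (p₁ A)) (hL₀.pullback (p₂ A))) =
      CechPic.pullback (p₂ A) (detClass hL₀) := by
    rw [detClass_tensorObj_of_hasRank_one (hasRank_pullback _ hU₁) (hasRank_pullback _ h₁) (hU₀.pullback (p₁ A)) (hL₀.pullback (p₂ A)),
      detClass_pullback (p₁ A) hU₀, detClass_pullback (p₂ A) hL₀, detClass_unitModule_eq_one, map_one, one_mul]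
  have rhs : detClass (isFiniteLocallyFree_tensorObj _ _ (hN₀.pullback (p₁ A)) (hL₀.pullback (m A))) =
      CechPic.pullback (p₁ A) (detClass hN₀) * CechPic.pullback (m A) (detClass hL₀) := by
    rw [detClass_tensorObj_of_hasRank_one (hasRank_pullback _ hN₁) (hasRank_pullback _ h₁) (hN₀.pullback (p₁ A)) (hL₀.pullback (m A)),
      detClass_pullback (p₁ A) hN₀, detClass_pullback (m A) hL₀]
  rw [lhs, rhs, hND, map_inv, hmul', ← hLD, inv_mul_cancel_left]

end Iso

/-! ## §3 The induction -/

section Head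

variable {k : Type} [Field k] [IsAlgClosed k] (B : AbelianVariety k) {L : B.X.left.Modules} (h₁ : HasRank L 1)
  (hL : IsHomogeneous B L) (hne : IsEmpty (L ≅ unitModule B.X.left))
  {I : Type} [LinearOrder I] [Fintype I] (U : I → B.X.left.affineOpens) (hcov : ⨆ i, (U i).1 = ⊤)

omit [IsAlgClosed k] in
/-- The ring map of ★ (K) `overRingHom (p₁ ≫ A.X.hom) φ₀` is the F-J3b base ring `ρ₂ = scalarRingHomTop (A.X ⊗ A.X)` (`p₁ ≫ (A → Spec k)`
is the structure map of `A × A`). [folklore] [cite: GortzWedhorn2023, Def. 21.68 (p. 180)] -/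
theorem overRingHom_p₁_comp_eq_ρ₂ :
    overRingHom (p₁ (AbelianSchemeOver.ofAbelianVariety B) ≫ B.X.hom) (Scheme.ΓSpecIso (.of k)).commRingCatIsoToRingEquiv.symm =
      ρ₂ (AbelianSchemeOver.ofAbelianVariety B) := by
  have hw : p₁ (AbelianSchemeOver.ofAbelianVariety B) ≫ B.X.hom = (B.X ⊗ B.X).hom := Over.w (fst B.X B.X)
  rw [hw]
  rfl

include h₁ hL hne hcov in
/-- **THE INDUCTION STEP** ([MumfordAV1970] §8 (vii)): if `Ȟᵃ(𝓤, L) = 0` for all `a < n` then `Ȟⁿ(𝓤, L) = 0` — through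
`Ȟ⁰(𝓤, 𝒪) ⊗ₖ Ȟⁿ(𝓤, L) ↪ Ȟⁿ(W₀, p₁^*𝒪 ⊗ p₂^*L) ≅ Ȟⁿ(W″, p₁^*𝒪(−D) ⊗ m^*L) = 0` (Künneth injection along `(p₁, p₂)`, the module isomorphism of §2
+ cover independence through the triple cover, Künneth vanishing along the shear square `(p₁, m)` with `Ȟ⁰(𝓤, 𝒪(−D)) = 0`), and `Ȟ⁰(𝓤, 𝒪) ≠ 0`.
[cite: MumfordAV1970, §8 (vii) (p. 76)] [cite: StacksProject, Tag 0BEC] [cite: GortzWedhorn2023, Cor. 22.110 and Lemma 27.197] -/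
theorem subsingleton_cechComplex_homology_step (n : ℤ)
    (ih : ∀ a : ℤ, a < n → Subsingleton ((cechComplex (fun i => (U i).1) L
      (overRingHom B.X.hom (Scheme.ΓSpecIso (.of k)).commRingCatIsoToRingEquiv.symm)).homology a)) :
    Subsingleton ((cechComplex (fun i => (U i).1) L
      (overRingHom B.X.hom (Scheme.ΓSpecIso (.of k)).commRingCatIsoToRingEquiv.symm)).homology n) := by
  set A := AbelianSchemeOver.ofAbelianVariety B with hA
  set φ₀ : k ≃+* Γ(Spec (.of k), ⊤) := (Scheme.ΓSpecIso (.of k)).commRingCatIsoToRingEquiv.symm with hφ₀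
  haveI : Fintype (I ×ₗ I) := inferInstanceAs (Fintype (I × I))
  haveI : Fintype ((I ×ₗ I) ×ₗ I) := inferInstanceAs (Fintype ((I ×ₗ I) × I))
  -- `L ≅ 𝒪(D)`, `L′ := 𝒪(−D)`
  obtain ⟨D, ⟨e⟩⟩ := exists_iso_lineBundle_toUnitCocycle h₁
  have hZ : ∀ P : B.Points k, (D.pullback (B.translation P).left).LinEquiv D := (isHomogeneous_iff_forall_linEquiv_of_iso B e).1 hL
  have hL₀ : IsFiniteLocallyFree L := HasRank.isFiniteLocallyFree' h₁
  have hN₁ : HasRank (lineBundle (-D).toUnitCocycle) 1 := (-D).toUnitCocycle.hasRank_lineBundle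
  have hN₀ : IsFiniteLocallyFree (lineBundle (-D).toUnitCocycle) := (-D).toUnitCocycle.isFiniteLocallyFree_lineBundle
  have hNhom : IsHomogeneous B (lineBundle (-D).toUnitCocycle) := isHomogeneous_lineBundle_neg B D hZ
  have hNne : IsEmpty (lineBundle (-D).toUnitCocycle ≅ unitModule B.X.left) := isEmpty_lineBundle_neg_iso_unit B h₁ hne e
  -- the three covers of `A × A`
  obtain ⟨W₀, hW₀⟩ := exists_productCover A.X A.X U U
  haveI : IsSeparated A.X.hom := inferInstanceAs (IsSeparated B.X.hom)
  obtain ⟨W, hW⟩ := exists_tripleCover W₀ (m A) U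
  obtain ⟨W'', hW''⟩ := exists_shearCover A U
  -- the two cartesian structures and the Leray data
  have Hpp : IsPullback (p₁ A) (p₂ A) B.X.hom B.X.hom := IsPullback.of_hasPullback B.X.hom B.X.hom
  have Hpm : IsPullback (p₁ A) (m A) B.X.hom B.X.hom := isPullback_p₁_m A
  have hUa' := hUa A U
  have hUloc : IsAffineLocalizing (unitModule B.X.left) := IsAffineLocalizing.unit
  have hLloc : IsAffineLocalizing L := isAffineLocalizing_of_isFiniteLocallyFree hL₀
  have hNloc : IsAffineLocalizing (lineBundle (-D).toUnitCocycle) := isAffineLocalizing_of_isFiniteLocallyFree hN₀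
  -- (1) Künneth vanishing along the shear square: `Ȟⁿ(W″, p₁^*𝒪(−D) ⊗ m^*L) = 0`
  have hM'flf : IsFiniteLocallyFree (boxTensor (p₁ A) (m A) (lineBundle (-D).toUnitCocycle) L) :=
    isFiniteLocallyFree_tensorObj _ _ (hN₀.pullback _) (hL₀.pullback _)
  haveI : Module.Finite k ((cechComplex (fun c => (W'' c).1) (boxTensor (p₁ A) (m A) (lineBundle (-D).toUnitCocycle) L)
      (overRingHom (p₁ A ≫ B.X.hom) φ₀)).homology n) := by
    rw [hφ₀, overRingHom_p₁_comp_eq_ρ₂ B]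
    haveI : IsProper (A.X ⊗ A.X).hom := by
      haveI : IsProper A.X.hom := A.isProper
      change IsProper (pullback.fst A.X.hom A.X.hom ≫ A.X.hom)
      infer_instance
    exact module_finite_homology_cechComplex_scalarRingHomTop (A.X ⊗ A.X) (fun c => (W'' c).1)
      (hW''cov A U hcov W₀ hW₀ W hW W'' hW'') (hW''a A W'') _ ⟨isAffineLocalizing_of_isFiniteLocallyFree hM'flf, IsFiniteLocallyFree.isAffineFiniteType hM'flf⟩ n
  have hvan : Subsingleton ((cechComplex (fun c => (W'' c).1) (boxTensor (p₁ A) (m A) (lineBundle (-D).toUnitCocycle) L)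
      (overRingHom (p₁ A ≫ B.X.hom) φ₀)).homology n) := by
    refine subsingleton_homology_boxTensor_of_forall (fun i => (U i).1) (fun i => (U i).1) Hpm hUa' hUa' hNloc hLloc φ₀ (fun c => (W'' c).1) hW'' n ?_
    intro a b hab
    by_cases hb : b < n
    · haveI := ih b hb
      exact subsingleton_tensor_of_right
    · have ha : a ≤ 0 := by omega
      rcases ha.lt_or_eq with ha | ha
      · haveI := subsingleton_cechComplex_homology_of_neg (fun i => (U i).1) (lineBundle (-D).toUnitCocycle) (overRingHom B.X.hom φ₀) a ha
        exact subsingleton_tensor_of_left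
      · subst ha
        haveI := subsingleton_cechComplex_homology_zero_of_isHomogeneous B hN₁ hNhom hNne (fun i => (U i).1) hcov (overRingHom B.X.hom φ₀)
        exact subsingleton_tensor_of_left
  -- (2) the module isomorphism + cover independence: `Ȟⁿ(W₀, p₁^*𝒪 ⊗ p₂^*L) = 0`
  obtain ⟨eM⟩ := nonempty_boxTensor_unit_iso_boxTensor_neg_mul B h₁ hL e
  haveI := hvan
  haveI hW₀van : Subsingleton ((cechComplex (W₀' A W₀) (boxTensor (p₁ A) (p₂ A) (unitModule B.X.left) L)
      (overRingHom (p₁ A ≫ B.X.hom) φ₀)).homology n) :=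
    subsingleton_homology_of_iso_of_common_refinement (W₀' A W₀) (W' A W) _ (overRingHom (p₁ A ≫ B.X.hom) φ₀)
      (hW₀a A W₀) (hWa A W) (hW₀cov A U hcov W₀ hW₀) (hWcov A U hcov W₀ hW₀ W hW)
      (isAffineLocalizing_of_isFiniteLocallyFree (isFiniteLocallyFree_tensorObj _ _
        ((HasRank.isFiniteLocallyFree' hasRank_unitModule).pullback _) (hL₀.pullback _)))
      (fun c => (W'' c).1) (hW''a A W'') (hW''cov A U hcov W₀ hW₀ W hW W'' hW'')
      (fun d => (ofLex d).1) (fun d => toLex ((ofLex (ofLex d).1).1, (ofLex d).2))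
      (refinedCover_le_productCover' A U W₀ W hW) (refinedCover_le_shearCover A U W₀ hW₀ W hW W'' hW'') eM n
  -- (3) Künneth injection along `(p₁, p₂)`: `Ȟ⁰(𝓤, 𝒪) ⊗ Ȟⁿ(𝓤, L) = 0`
  haveI hT : Subsingleton (((cechComplex (fun i => (U i).1) (unitModule B.X.left) (overRingHom B.X.hom φ₀)).homology 0 : Type) ⊗[k]
      ((cechComplex (fun i => (U i).1) L (overRingHom B.X.hom φ₀)).homology n : Type)) :=
    subsingleton_tensor_homology_of_subsingleton_homology_boxTensor (fun i => (U i).1) (fun i => (U i).1) Hpp hUa' hUa' hUloc hLloc φ₀ (W₀' A W₀) hW₀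
      0 n n (zero_add n)
  -- (4) `Ȟ⁰(𝓤, 𝒪) ≠ 0`
  haveI := nontrivial_cechComplex_homology_zero_unitModule (fun i => (U i).1) (overRingHom B.X.hom φ₀) hcov
  obtain ⟨m₀, hm₀⟩ := exists_ne (0 : (cechComplex (fun i => (U i).1) (unitModule B.X.left) (overRingHom B.X.hom φ₀)).homology 0)
  exact subsingleton_of_subsingleton_tensor_of_ne_zero (k := k) hm₀

include h₁ hL hne hcov in
/-- **`H^i(A, L) = 0` FOR ALL `i`, FOR A NON-TRIVIAL HOMOGENEOUS LINE BUNDLE** ([MumfordAV1970] §8 (vii); [GortzWedhorn2023] Lemma 27.197): for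
an abelian variety `A` over an ALGEBRAICALLY CLOSED field `k`, `L` of rank one with `t_P^*L ≅ L` for all `P ∈ A(k)` and `L ≇ 𝒪_A`, and EVERY
finite affine open cover `𝓤` of `A`: the ordered module Čech cohomology `Ȟⁿ(𝓤, L)` vanishes for every `n : ℤ` (scalars `k` through
`overRingHom A.X.hom φ₀`, the ring of ★ (K)).  Strong induction on `n` with `subsingleton_cechComplex_homology_step`.
[cite: MumfordAV1970, §8 (vii) (p. 76)] [cite: GortzWedhorn2023, Lemma 27.197 (PDF p. 893)] -/
theorem subsingleton_cechComplex_homology_of_isHomogeneous (n : ℤ) :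
    Subsingleton ((cechComplex (fun i => (U i).1) L
      (overRingHom B.X.hom (Scheme.ΓSpecIso (.of k)).commRingCatIsoToRingEquiv.symm)).homology n) := by
  -- strong induction on `n.toNat`, negative degrees being trivial
  suffices h : ∀ N : ℕ, ∀ n : ℤ, n < N → Subsingleton ((cechComplex (fun i => (U i).1) L
      (overRingHom B.X.hom (Scheme.ΓSpecIso (.of k)).commRingCatIsoToRingEquiv.symm)).homology n) from
    h (n.toNat + 1) n (by omega)
  intro N
  induction N with
  | zero =>
    intro n hn
    exact subsingleton_cechComplex_homology_of_neg _ L _ n (by omega)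
  | succ N ihN =>
    intro n hn
    by_cases hn' : n < N
    · exact ihN n hn'
    · exact subsingleton_cechComplex_homology_step B h₁ hL hne U hcov n fun a ha => ihN a (by omega)

omit [IsAlgClosed k] in
/-- `overRingHom A.X.hom φ₀` IS the F-J3b base ring `ρ₁ = scalarRingHomTop A.X`. [folklore] [cite: GortzWedhorn2023, Def. 21.68 (p. 180)] -/
theorem overRingHom_hom_eq_scalarRingHomTop :
    overRingHom B.X.hom (Scheme.ΓSpecIso (.of k)).commRingCatIsoToRingEquiv.symm = scalarRingHomTop B.X := rfl

include h₁ hL hne hcov in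
/-- **The same for the F-J3b scalars `scalarRingHomTop A.X`** (the ring of ★ `AbelianVarietyCechProductMaps` ∕ `CechH1DimOfCharZeroByTransport`'s
ordered cousins): `Ȟⁿ(𝓤, L) = 0` for all `n`. [cite: MumfordAV1970, §8 (vii) (p. 76)] [cite: GortzWedhorn2023, Lemma 27.197 (PDF p. 893)] -/
theorem subsingleton_cechComplex_homology_of_isHomogeneous' (n : ℤ) :
    Subsingleton ((cechComplex (fun i => (U i).1) L (scalarRingHomTop B.X)).homology n) := by
  rw [← overRingHom_hom_eq_scalarRingHomTop B]
  exact subsingleton_cechComplex_homology_of_isHomogeneous B h₁ hL hne U hcov n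

end Head

end Literature.AlgebraicGeometry.AbelianVarieties

end
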